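import Literature.Combinatorics.Additive.DeZeeuwPointPlaneReduction
import Literature.Combinatorics.Extremal.LowDegreeSurfaceThroughLines
import Mathlib.Algebra.MvPolynomial.NoZeroDivisors
import Mathlib.Data.Nat.Sqrt
import Mathlib.RingTheory.Polynomial.UniqueFactorization
import Mathlib.RingTheory.UniqueFactorizationDomain.Basic
import HarnessLib

/-!
# The bipartite Guth–Katz line bound from its single-surface case (de Zeeuw 2016, §3)

Topic `Literature/Combinatorics/Additive` (incidence geometry over arbitrary fields). Everything in
this file is PROVED; the one deep input is an explicit hypothesis, stated inline.

F. de Zeeuw, *A short proof of Rudnev's point–plane incidence bound*, arXiv:1612.02719 (2016),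
**Lemma 3.1** (the bipartite Guth–Katz intersection bound over an arbitrary field `𝔽`):

> Let `L, M` be two finite sets of lines in `𝔽³`. Assume that `|L| ≤ |M|`, and if `𝔽` has
> positive characteristic `p`, assume that `|L| = O(p²)`. Suppose that no quadric contains `s`
> lines of `L` and `t` lines of `M`. Then `I(L, M) = O(|L|^{1/2}|M| + t|L| + s|M|)`.

This is exactly the hypothesis `H` of
`Literature.Combinatorics.Additive.rudnev_pointPlaneIncidence_of_lineIntersection` (de Zeeuw
§§2, 4, proved in `DeZeeuwPointPlaneReduction.lean`), hence all that separates the named fact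
`Literature.Combinatorics.Additive.stevensDeZeeuw_thm4` from a proof. The printed proof of
Lemma 3.1 (loc. cit., §3) is an assembly of

1. interpolation: a surface `S = {f = 0}` of degree `O(|L|^{1/2})` containing all lines of `L`
   ([Kollar2015, Lemma 10 (1)] — PROVED: `Literature.Combinatorics.Extremal.exists_surface_through_lines`);
2. decomposition of `S` into irreducible components and Bézout on a line ("a line `m` has
   `O(|L|^{1/2})` intersection points with components of `S` that do not contain `m`");
3. the hypothesis, for the components that are planes or quadrics;
4. for every other component `Sᵢ` (irreducible of degree `dᵢ ≥ 3`) the two results of Kollár's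
   theory of lines on surfaces over arbitrary fields: "By [K, Prop. 55], there are at most two
   special lines in `Sᵢ` that intersect infinitely many other lines in `Sᵢ` … Any other line
   intersects at most `deg(Sᵢ)` lines in `Sᵢ`" (ruled `Sᵢ`; for a cone all lines pass through
   the vertex [K, §7 (54)]), and "a non-ruled component `Sᵢ` contains `O(deg(Sᵢ)³)`
   intersection points between lines contained in it" [K, Cor. 21; in characteristic `p` for
   `deg Sᵢ < p`, K, Cor. 40 and the remark before it (Monge's theorem for degree `< p`)].

This file PROVES the assembly 1–3 and isolates 4 as the single inline hypothesis `GKK`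
("component bound"), in the notion-free form in which 4 is used: *there is an absolute
constant `C_K` such that for every field `K`, every irreducible `f ∈ K[X₀,X₁,X₂]` of total
degree `d ≥ 3` with `char K = 0` or `d < char K`, all finite disjoint sets `L', M'` of lines of
`K³` on `{f = 0}`, every finite set of points each lying on a line of `L'` and a line of `M'` has
at most `C_K (d³ + d |L'| + |M'|)` elements* (ruled non-conical `f`: `≤ d|L'| + 2|M'|` by
[K, Prop. 55 (4), (5)]; cones: `≤ 1`; non-ruled: `≤ 66 d³` by [K, Cor. 21]). The Cayley–Salmon–
Monge flecnode theorem, the arithmetic genus of complete-intersection curves and the structure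
of ruled surfaces behind `GKK` are deliberately NOT reproduced here.

Main results:
* `DeZeeuw.lineIntersection_small_of_componentBound` — Lemma 3.1 with an ABSOLUTE constant for
  configurations with `6|L| < p²` (so that the interpolating surface has degree `< p`), from
  `GKK`; this is the printed proof.
* `lineIntersection_of_componentBound` — Lemma 3.1 as stated in `H` (`|L| ≤ c₀ p²` for any
  `c₀`), by splitting `L` into `O(c₀)` pieces (and the trivial bound for `p = 2`).
* `rudnev_pointPlaneIncidence_of_componentBound`, `stevensDeZeeuw_thm4_of_componentBound` —
  the chain down to the named fact.
* `lineIntersection_of_componentBound_at` (one field, explicit constant) and the `_closed`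
  variants `lineIntersection_of_componentBound_closed`,
  `rudnev_pointPlaneIncidence_of_componentBound_closed`,
  `stevensDeZeeuw_thm4_of_componentBound_closed` — the same chain with `GKK` assumed ONLY for
  algebraically closed `K` (the setting of [K, §7]; the reduction to the named fact passes to
  `AlgebraicClosure 𝔽` anyway). This is the sharpest form: the one remaining input concerns a
  single absolutely irreducible surface of degree `d ≥ 3` over an algebraically closed field.

## References
* [deZeeuw2016] F. de Zeeuw, arXiv:1612.02719 — Lemma 3.1 and its proof (§3).
* [Kollar2015] J. Kollár, *Szemerédi–Trotter-type theorems in dimension 3*, Adv. Math. 271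
  (2015) 30–61 — Lemma 10, Prop. 55, Cor. 21, Cor. 40, §7 (54).
* [StevensDeZeeuw2017] S. Stevens, F. de Zeeuw, Bull. LMS 49 (2017) — Theorem 4, Theorem 6.
-/

namespace Literature.Combinatorics.Additive

open Finset MvPolynomial

namespace DeZeeuw

/-! ### Lines: parametrizations; two lines meet in at most one point -/

section LinesParam

variable {K : Type*} [Field K]

/-- A line (affine subspace with direction of rank `1`) is `{u + t v : t ∈ K}` for some `u` and
`v ≠ 0`. [folklore] -/
theorem exists_param (ℓ : AffineSubspace K (Fin 3 → K))
    (h : Module.finrank K ℓ.direction = 1) :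
    ∃ uv : (Fin 3 → K) × (Fin 3 → K), uv.2 ≠ 0 ∧ ∀ z, z ∈ ℓ ↔ ∃ t : K, z = uv.1 + t • uv.2 := by
  have hne : (ℓ : Set (Fin 3 → K)).Nonempty := by
    rw [AffineSubspace.nonempty_iff_ne_bot]
    intro hbot
    rw [hbot, AffineSubspace.direction_bot, finrank_bot] at h
    omega
  obtain ⟨u, hu⟩ := hne
  obtain ⟨v, hv, hspan⟩ := finrank_eq_one_iff'.1 h
  refine ⟨(u, (v : Fin 3 → K)), fun h0 => hv (Submodule.coe_eq_zero.mp h0), fun z => ?_⟩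
  rw [← AffineSubspace.vsub_right_mem_direction_iff_mem hu z]
  constructor
  · intro hz
    obtain ⟨c, hc⟩ := hspan ⟨z -ᵥ u, hz⟩
    refine ⟨c, ?_⟩
    have := congrArg Subtype.val hc
    simp only [SetLike.val_smul] at this
    rw [vsub_eq_sub] at this
    simp only
    rw [this]; abel
  · rintro ⟨t, rfl⟩
    have : (u + t • (v : Fin 3 → K)) -ᵥ u = t • (v : Fin 3 → K) := by
      rw [vsub_eq_sub]; abel
    simp only at this ⊢
    rw [this]
    exact ℓ.direction.smul_mem t v.2

/-- Two distinct lines meet in at most one point. [folklore] -/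
theorem eq_of_mem_of_mem {ℓ m : AffineSubspace K (Fin 3 → K)}
    (hℓ : Module.finrank K ℓ.direction = 1) (hm : Module.finrank K m.direction = 1)
    (hne : ℓ ≠ m) {z z' : Fin 3 → K} (hz : z ∈ ℓ) (hzm : z ∈ m) (hz' : z' ∈ ℓ)
    (hz'm : z' ∈ m) : z = z' := by
  by_contra hzz
  have hv : z' -ᵥ z ≠ 0 := fun h0 => hzz (eq_of_vsub_eq_zero h0).symm
  have hvℓ : z' -ᵥ z ∈ ℓ.direction := AffineSubspace.vsub_mem_direction hz' hz
  have hvm : z' -ᵥ z ∈ m.direction := AffineSubspace.vsub_mem_direction hz'm hzm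
  have key : ∀ S : Submodule K (Fin 3 → K), Module.finrank K S = 1 → z' -ᵥ z ∈ S →
      S = K ∙ (z' -ᵥ z) := by
    intro S hS hmem
    haveI : FiniteDimensional K S := Module.finite_of_finrank_eq_succ hS
    refine (Submodule.eq_of_le_of_finrank_eq
      ((Submodule.span_singleton_le_iff_mem _ _).2 hmem) ?_).symm
    rw [finrank_span_singleton hv, hS]
  exact hne (AffineSubspace.ext_of_direction_eq ((key _ hℓ hvℓ).trans (key _ hm hvm).symm)
    ⟨z, hz, hzm⟩)

end LinesParam

/-! ### Restrictions to lines, irreducible factors -/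

section Factors

variable {K : Type*} [Field K]

/-- The restriction `g(u + t v) ∈ K[t]` of `g` to the parametrized line `u + t v`. [folklore] -/
noncomputable def lineRes (u v : Fin 3 → K) (g : MvPolynomial (Fin 3) K) : Polynomial K :=
  MvPolynomial.aeval (fun i => Polynomial.C (u i) + Polynomial.C (v i) * Polynomial.X) g

/-- `lineRes` is multiplicative. [folklore] -/
theorem lineRes_mul (u v : Fin 3 → K) (g h : MvPolynomial (Fin 3) K) :
    lineRes u v (g * h) = lineRes u v g * lineRes u v h := map_mul _ _ _

/-- Formal vanishing on a line implies vanishing at its points. [folklore] -/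
theorem eval_of_lineRes_eq_zero {u v : Fin 3 → K} {g : MvPolynomial (Fin 3) K}
    (h : lineRes u v g = 0) (t : K) : eval (u + t • v) g = 0 := by
  rw [← Literature.Combinatorics.Extremal.eval_aeval_line u v g t]
  show (lineRes u v g).eval t = 0
  rw [h, Polynomial.eval_zero]

/-- **Bézout on a line, for point sets**: if `g` does not vanish formally on the line
`{u + t v}`, a finite set of points of that line on which `g` vanishes has at most
`deg g` elements. [folklore] -/
theorem card_le_totalDegree_of_lineRes_ne_zero {u v : Fin 3 → K}
    {g : MvPolynomial (Fin 3) K} (hg : lineRes u v g ≠ 0) (S : Finset (Fin 3 → K))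
    (hS : ∀ z ∈ S, (∃ t : K, z = u + t • v) ∧ eval z g = 0) : S.card ≤ g.totalDegree := by
  classical
  choose! τ hτ using fun z hz => (hS z hz).1
  have hinj : Set.InjOn τ S := fun z hz z' hz' h => by rw [hτ z hz, hτ z' hz', h]
  rw [← card_image_of_injOn hinj]
  have hall : (S.image τ).filter (fun t => eval (u + t • v) g = 0) = S.image τ := by
    refine filter_true_of_mem fun t ht => ?_
    obtain ⟨z, hz, rfl⟩ := mem_image.1 ht
    rw [← hτ z hz]
    exact (hS z hz).2
  rw [← hall]
  exact Literature.Combinatorics.Extremal.card_filter_eval_line_eq_zero_le u v g _ hg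

/-- The set of irreducible factors of `f`. [folklore] -/
noncomputable def facs (f : MvPolynomial (Fin 3) K) : Finset (MvPolynomial (Fin 3) K) := by
  classical exact (UniqueFactorizationMonoid.factors f).toFinset

/-- Membership in `facs`. [folklore] -/
theorem mem_facs {f g : MvPolynomial (Fin 3) K} :
    g ∈ facs f ↔ g ∈ UniqueFactorizationMonoid.factors f := by
  classical
  unfold facs
  rw [Multiset.mem_toFinset]

/-- Factors are irreducible. [folklore] -/
theorem irreducible_of_mem_facs {f g : MvPolynomial (Fin 3) K} (hg : g ∈ facs f) :
    Irreducible g :=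
  UniqueFactorizationMonoid.irreducible_of_factor g (mem_facs.1 hg)

/-- `0` is not a factor. [folklore] -/
theorem zero_notMem_facs (f : MvPolynomial (Fin 3) K) :
    (0 : MvPolynomial (Fin 3) K) ∉ facs f :=
  fun h => (irreducible_of_mem_facs h).ne_zero rfl

/-- Factors divide. [folklore] -/
theorem dvd_of_mem_facs {f g : MvPolynomial (Fin 3) K} (hg : g ∈ facs f) : g ∣ f :=
  UniqueFactorizationMonoid.dvd_of_mem_factors (mem_facs.1 hg)

/-- A zero of a factor is a zero of `f`. [folklore] -/
theorem eval_eq_zero_of_mem_facs {f g : MvPolynomial (Fin 3) K} (hg : g ∈ facs f)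
    {z : Fin 3 → K} (h : eval z g = 0) : eval z f = 0 := by
  obtain ⟨q, rfl⟩ := dvd_of_mem_facs hg
  rw [map_mul, h, zero_mul]

/-- If `f ≠ 0` vanishes formally on a line then so does one of its irreducible factors
(`K[t]` is a domain). [cite: deZeeuw2016, Lemma 3.1 (proof: "we assign every line … to one
component containing that line")] -/
theorem exists_mem_facs_lineRes_eq_zero {f : MvPolynomial (Fin 3) K} (hf : f ≠ 0)
    {u v : Fin 3 → K} (h : lineRes u v f = 0) : ∃ g ∈ facs f, lineRes u v g = 0 := by
  classical
  obtain ⟨w, hw⟩ := UniqueFactorizationMonoid.factors_prod hf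
  have h1 : lineRes u v ((UniqueFactorizationMonoid.factors f).prod) = 0 := by
    have e : lineRes u v f = lineRes u v (UniqueFactorizationMonoid.factors f).prod *
        lineRes u v (w : MvPolynomial (Fin 3) K) := by
      rw [← lineRes_mul, hw]
    rw [h] at e
    have hwu : IsUnit (lineRes u v (w : MvPolynomial (Fin 3) K)) := (Units.isUnit w).map _
    exact (mul_eq_zero.1 e.symm).resolve_right hwu.ne_zero
  unfold lineRes at h1
  rw [map_multiset_prod, Multiset.prod_eq_zero_iff, Multiset.mem_map] at h1
  obtain ⟨g, hg, hg0⟩ := h1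
  exact ⟨g, mem_facs.2 hg, hg0⟩

/-- If `f ≠ 0` vanishes at a point then so does one of its irreducible factors. [folklore] -/
theorem exists_mem_facs_eval_eq_zero {f : MvPolynomial (Fin 3) K} (hf : f ≠ 0)
    {z : Fin 3 → K} (h : eval z f = 0) : ∃ g ∈ facs f, eval z g = 0 := by
  classical
  obtain ⟨w, hw⟩ := UniqueFactorizationMonoid.factors_prod hf
  have h1 : eval z ((UniqueFactorizationMonoid.factors f).prod) = 0 := by
    have e : eval z f = eval z (UniqueFactorizationMonoid.factors f).prod *
        eval z (w : MvPolynomial (Fin 3) K) := by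
      rw [← map_mul, hw]
    rw [h] at e
    have hwu : IsUnit (eval z (w : MvPolynomial (Fin 3) K)) := (Units.isUnit w).map _
    exact (mul_eq_zero.1 e.symm).resolve_right hwu.ne_zero
  rw [map_multiset_prod, Multiset.prod_eq_zero_iff, Multiset.mem_map] at h1
  obtain ⟨g, hg, hg0⟩ := h1
  exact ⟨g, mem_facs.2 hg, hg0⟩

/-- Total degree of a product of nonzero polynomials over a field. [folklore] -/
theorem totalDegree_multiset_prod_eq (s : Multiset (MvPolynomial (Fin 3) K))
    (hs : (0 : MvPolynomial (Fin 3) K) ∉ s) :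
    s.prod.totalDegree = (s.map totalDegree).sum := by
  induction s using Multiset.induction_on with
  | empty => simp
  | cons a s ih =>
    rw [Multiset.prod_cons, Multiset.map_cons, Multiset.sum_cons]
    have ha : a ≠ 0 := fun h => hs (h ▸ Multiset.mem_cons_self _ _)
    have hs' : (0 : MvPolynomial (Fin 3) K) ∉ s := fun h => hs (Multiset.mem_cons_of_mem h)
    have hprod : s.prod ≠ 0 := Multiset.prod_ne_zero hs'
    rw [totalDegree_mul_of_isDomain ha hprod, ih hs']

/-- The degrees of the distinct irreducible factors add up to at most the degree
("we decompose `S` into irreducible components `S₁, …, Sₙ`", `∑ deg Sᵢ ≤ deg S`).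
[cite: deZeeuw2016, Lemma 3.1 (proof)] -/
theorem sum_totalDegree_facs_le {f : MvPolynomial (Fin 3) K} (hf : f ≠ 0) :
    ∑ g ∈ facs f, g.totalDegree ≤ f.totalDegree := by
  classical
  obtain ⟨w, hw⟩ := UniqueFactorizationMonoid.factors_prod hf
  set s := UniqueFactorizationMonoid.factors f with hs
  have h0 : (0 : MvPolynomial (Fin 3) K) ∉ s := fun h =>
    (UniqueFactorizationMonoid.irreducible_of_factor _ h).ne_zero rfl
  have hprod : s.prod ≠ 0 := Multiset.prod_ne_zero h0
  have hw0 : (w : MvPolynomial (Fin 3) K) ≠ 0 := Units.ne_zero w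
  have hdeg : f.totalDegree =
      (s.map totalDegree).sum + (w : MvPolynomial (Fin 3) K).totalDegree := by
    rw [← hw, totalDegree_mul_of_isDomain hprod hw0, totalDegree_multiset_prod_eq s h0]
  rw [hdeg]
  refine le_trans ?_ (Nat.le_add_right _ _)
  have : facs f = s.toFinset := by unfold facs; rfl
  rw [this, Finset.sum_multiset_map_count]
  exact Finset.sum_le_sum fun g hg => Nat.le_mul_of_pos_left _
    (Multiset.count_pos.2 (Multiset.mem_toFinset.1 hg))

/-- A factor has degree at most `deg f`. [folklore] -/
theorem totalDegree_le_of_mem_facs {f g : MvPolynomial (Fin 3) K} (hf : f ≠ 0)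
    (hg : g ∈ facs f) : g.totalDegree ≤ f.totalDegree :=
  le_trans (single_le_sum (f := fun g => g.totalDegree) (fun _ _ => Nat.zero_le _) hg)
    (sum_totalDegree_facs_le hf)

open Classical in
/-- An injective numbering of the factors (the "index" of de Zeeuw's proof). [folklore] -/
noncomputable def rk (f : MvPolynomial (Fin 3) K) (g : MvPolynomial (Fin 3) K) : ℕ :=
  if h : g ∈ facs f then ((facs f).equivFin ⟨g, h⟩ : ℕ) else 0

/-- `rk f` is injective on the factors. [folklore] -/
theorem rk_injOn (f : MvPolynomial (Fin 3) K) {g g' : MvPolynomial (Fin 3) K}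
    (hg : g ∈ facs f) (hg' : g' ∈ facs f) (h : rk f g = rk f g') : g = g' := by
  classical
  rw [rk, rk, dif_pos hg, dif_pos hg'] at h
  have := (facs f).equivFin.injective (Fin.ext h)
  exact congrArg Subtype.val this

end Factors

/-! ### Two counting devices -/

section Counting

/-- Fibres of a map over a finite index set are disjoint: their sizes add up to at most the
size of the source. [folklore] -/
theorem sum_card_filter_eq_le {α β : Type*} [DecidableEq β] (M : Finset α) (G : Finset β)
    (φ : α → β) : ∑ g ∈ G, (M.filter fun m => φ m = g).card ≤ M.card := by
  classical
  rw [← card_biUnion]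
  · exact card_le_card (biUnion_subset.2 fun g _ => filter_subset _ _)
  · intro g _ g' _ hne
    simp only [Function.onFun]
    rw [disjoint_filter]
    intro m _ h h'
    exact hne (h.symm.trans h')

/-- `∑ dᵢ³ ≤ (∑ dᵢ)²·(∑ dᵢ) ≤ D³` when `∑ dᵢ ≤ D`. [folklore] -/
theorem sum_pow_three_le {α : Type*} (G : Finset α) (d : α → ℕ) {D : ℕ}
    (h : ∑ g ∈ G, d g ≤ D) : ∑ g ∈ G, d g ^ 3 ≤ D ^ 3 := by
  have hle : ∀ g ∈ G, d g ≤ D := fun g hg =>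
    le_trans (single_le_sum (f := d) (fun _ _ => Nat.zero_le _) hg) h
  calc ∑ g ∈ G, d g ^ 3 ≤ ∑ g ∈ G, d g * D ^ 2 :=
        sum_le_sum fun g hg => by
          rw [pow_succ, pow_two, pow_two]
          exact Nat.mul_le_mul (Nat.mul_le_mul (le_refl _) (hle g hg)) (hle g hg) |>.trans
            (le_of_eq (by ring))
    _ = (∑ g ∈ G, d g) * D ^ 2 := (sum_mul _ _ _).symm
    _ ≤ D * D ^ 2 := Nat.mul_le_mul_right _ h
    _ = D ^ 3 := by ring

end Counting

/-! ### Lemma 3.1 for one piece `L₀ ⊆ L` with `6|L₀| < p²` (the printed proof) -/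

section PieceBound

/-- The uniform per-piece quantity
`X = D|M| + D|L| + s|M| + t|L| + C_K (D³ + D|L| + |M|)`, `D = ⌊√(6|L|)⌋`. [folklore] -/
noncomputable def pieceBound (CK : ℝ) (l m s t : ℕ) : ℝ :=
  ((Nat.sqrt (6 * l) * m + Nat.sqrt (6 * l) * l + s * m + t * l : ℕ) : ℝ) +
    CK * ((Nat.sqrt (6 * l) : ℝ) ^ 3 + Nat.sqrt (6 * l) * l + m)

/-- `pieceBound` is monotone in `l`. [folklore] -/
theorem pieceBound_mono {CK : ℝ} (hCK : 0 ≤ CK) {l l' : ℕ} (h : l ≤ l') (m s t : ℕ) :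
    pieceBound CK l m s t ≤ pieceBound CK l' m s t := by
  unfold pieceBound
  have hD : Nat.sqrt (6 * l) ≤ Nat.sqrt (6 * l') := Nat.sqrt_le_sqrt (Nat.mul_le_mul_left 6 h)
  have hD' : (Nat.sqrt (6 * l) : ℝ) ≤ Nat.sqrt (6 * l') := by exact_mod_cast hD
  have h' : (l : ℝ) ≤ l' := by exact_mod_cast h
  have hn : (Nat.sqrt (6 * l) * m + Nat.sqrt (6 * l) * l + s * m + t * l : ℕ) ≤
      Nat.sqrt (6 * l') * m + Nat.sqrt (6 * l') * l' + s * m + t * l' := by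
    gcongr
  have hn' : ((Nat.sqrt (6 * l) * m + Nat.sqrt (6 * l) * l + s * m + t * l : ℕ) : ℝ) ≤
      ((Nat.sqrt (6 * l') * m + Nat.sqrt (6 * l') * l' + s * m + t * l' : ℕ) : ℝ) := by
    exact_mod_cast hn
  have hr : (Nat.sqrt (6 * l) : ℝ) ^ 3 + Nat.sqrt (6 * l) * l + m ≤
      (Nat.sqrt (6 * l') : ℝ) ^ 3 + Nat.sqrt (6 * l') * l' + m := by
    gcongr
  exact add_le_add hn' (mul_le_mul_of_nonneg_left hr hCK)

/-- `pieceBound` is nonnegative. [folklore] -/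
theorem pieceBound_nonneg {CK : ℝ} (hCK : 0 ≤ CK) (l m s t : ℕ) : 0 ≤ pieceBound CK l m s t := by
  unfold pieceBound
  positivity

end PieceBound

section Small

variable {K : Type*} [Field K]

open scoped Classical in
/-- **Step 2 of the printed proof** ("a line `m ∈ M` has `O(|L|^{1/2})` intersection points
with components of `S` that do not contain `m`"): among points each lying on a chosen line
`pick z` of a family `N`, those lying on some irreducible component of `{f = 0}` that does not
contain (formally) the line `pick z` number at most `|N| · deg f` (Bézout on each line, summed
over the components, `∑ deg fᵢ ≤ deg f`). [cite: deZeeuw2016, Lemma 3.1 (proof, §3)] -/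
theorem card_filter_offComponent_le {f : MvPolynomial (Fin 3) K} (hf : f ≠ 0)
    (N : Finset (AffineSubspace K (Fin 3 → K)))
    (uv : AffineSubspace K (Fin 3 → K) → (Fin 3 → K) × (Fin 3 → K))
    (huv : ∀ n ∈ N, ∀ z, z ∈ n ↔ ∃ t : K, z = (uv n).1 + t • (uv n).2)
    (I : Finset (Fin 3 → K)) (pick : (Fin 3 → K) → AffineSubspace K (Fin 3 → K))
    (hpick : ∀ z ∈ I, pick z ∈ N ∧ z ∈ pick z) :
    (I.filter fun z => ∃ g ∈ facs f, eval z g = 0 ∧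
        lineRes (uv (pick z)).1 (uv (pick z)).2 g ≠ 0).card ≤ N.card * f.totalDegree := by
  have hsub : (I.filter fun z => ∃ g ∈ facs f, eval z g = 0 ∧
      lineRes (uv (pick z)).1 (uv (pick z)).2 g ≠ 0) ⊆
      (N ×ˢ facs f).biUnion fun ng => I.filter fun z =>
        pick z = ng.1 ∧ eval z ng.2 = 0 ∧ lineRes (uv ng.1).1 (uv ng.1).2 ng.2 ≠ 0 := by
    intro z hz
    rw [mem_filter] at hz
    obtain ⟨hzI, g, hg, hzg, hne⟩ := hz
    rw [mem_biUnion]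
    exact ⟨(pick z, g), mem_product.2 ⟨(hpick z hzI).1, hg⟩, mem_filter.2 ⟨hzI, rfl, hzg, hne⟩⟩
  refine (card_le_card hsub).trans (card_biUnion_le.trans ?_)
  calc ∑ ng ∈ N ×ˢ facs f, (I.filter fun z => pick z = ng.1 ∧ eval z ng.2 = 0 ∧
          lineRes (uv ng.1).1 (uv ng.1).2 ng.2 ≠ 0).card
      ≤ ∑ ng ∈ N ×ˢ facs f, ng.2.totalDegree := by
        refine sum_le_sum fun ng hng => ?_
        obtain ⟨hn', hg⟩ := mem_product.1 hng
        by_cases hres : lineRes (uv ng.1).1 (uv ng.1).2 ng.2 = 0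
        · rw [card_eq_zero.2]
          · exact Nat.zero_le _
          · rw [eq_empty_iff_forall_notMem]
            intro z hz
            exact (mem_filter.1 hz).2.2.2 hres
        · refine card_le_totalDegree_of_lineRes_ne_zero hres _ fun z hz => ?_
          obtain ⟨hzI, hzn', hzg, -⟩ := mem_filter.1 hz
          refine ⟨(huv ng.1 hn' z).1 ?_, hzg⟩
          rw [← hzn']
          exact (hpick z hzI).2
    _ = N.card * ∑ g ∈ facs f, g.totalDegree := by
        rw [sum_product]
        dsimp only
        rw [sum_const, smul_eq_mul]
    _ ≤ N.card * f.totalDegree := Nat.mul_le_mul_left _ (sum_totalDegree_facs_le hf)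

open scoped Classical in
/-- **Steps 3–4 of the printed proof, for one component `{g = 0}`**: the points whose two
lines are both assigned to the irreducible factor `g` number at most `s|M_g| + t|L_g|` if
`deg g ≤ 2` (the hypothesis on planes and quadrics) and at most
`C_K (deg(g)³ + deg(g)|L_g| + |M_g|)` if `deg g ≥ 3` (the component bound); here `L_g, M_g` are
the lines of `L₀, M` assigned to `g`. [cite: deZeeuw2016, Lemma 3.1 (proof, §3)] -/
theorem card_sameComponent_le {CK : ℝ} (hCK : 0 ≤ CK)
    (hGKK : ∀ f : MvPolynomial (Fin 3) K, Irreducible f → 3 ≤ f.totalDegree →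
      (ringChar K = 0 ∨ f.totalDegree < ringChar K) →
      ∀ (L M : Finset (AffineSubspace K (Fin 3 → K))),
        (∀ ℓ ∈ L, Module.finrank K ℓ.direction = 1) →
        (∀ m ∈ M, Module.finrank K m.direction = 1) → Disjoint L M →
        (∀ ℓ ∈ L, ∀ z ∈ ℓ, eval z f = 0) → (∀ m ∈ M, ∀ z ∈ m, eval z f = 0) →
        ∀ I : Finset (Fin 3 → K), (∀ z ∈ I, (∃ ℓ ∈ L, z ∈ ℓ) ∧ (∃ m ∈ M, z ∈ m)) →
          (I.card : ℝ) ≤ CK * ((f.totalDegree : ℝ) ^ 3 + f.totalDegree * L.card + M.card))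
    (L M : Finset (AffineSubspace K (Fin 3 → K))) (s t : ℕ)
    (hL : ∀ ℓ ∈ L, Module.finrank K ℓ.direction = 1)
    (hM : ∀ m ∈ M, Module.finrank K m.direction = 1) (hLM : Disjoint L M)
    (hquad : ∀ G : MvPolynomial (Fin 3) K, G ≠ 0 → G.totalDegree ≤ 2 →
      (L.filter fun ℓ => ∀ z ∈ ℓ, eval z G = 0).card < s ∨
      (M.filter fun m => ∀ z ∈ m, eval z G = 0).card < t)
    (L₀ : Finset (AffineSubspace K (Fin 3 → K))) (hL₀ : L₀ ⊆ L)
    {f : MvPolynomial (Fin 3) K} {D : ℕ} (hdegD : ∀ g ∈ facs f, g.totalDegree ≤ D)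
    (hchar : ringChar K = 0 ∨ D < ringChar K)
    (uv : AffineSubspace K (Fin 3 → K) → (Fin 3 → K) × (Fin 3 → K))
    (hptw : ∀ n ∈ L₀ ∪ M, ∀ g : MvPolynomial (Fin 3) K, lineRes (uv n).1 (uv n).2 g = 0 →
      ∀ z ∈ n, eval z g = 0)
    (asg : AffineSubspace K (Fin 3 → K) → MvPolynomial (Fin 3) K)
    (hasgF : ∀ n, asg n ∈ facs f → lineRes (uv n).1 (uv n).2 (asg n) = 0)
    (ℓ m : (Fin 3 → K) → AffineSubspace K (Fin 3 → K)) {g : MvPolynomial (Fin 3) K}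
    (hg : g ∈ facs f) (J : Finset (Fin 3 → K))
    (hJ : ∀ z ∈ J, (ℓ z ∈ L₀ ∧ z ∈ ℓ z ∧ asg (ℓ z) = g) ∧ (m z ∈ M ∧ z ∈ m z ∧ asg (m z) = g)) :
    (J.card : ℝ) ≤ s * (M.filter fun n => asg n = g).card + t * (L₀.filter fun n => asg n = g).card
      + CK * ((g.totalDegree : ℝ) ^ 3 + g.totalDegree * (L₀.filter fun n => asg n = g).card
        + (M.filter fun n => asg n = g).card) := by
  obtain ⟨Lg, hLg⟩ : ∃ S, S = L₀.filter fun n => asg n = g := ⟨_, rfl⟩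
  obtain ⟨Mg, hMg⟩ : ∃ S, S = M.filter fun n => asg n = g := ⟨_, rfl⟩
  rw [← hLg, ← hMg]
  have hL₀1 : ∀ ℓ ∈ L₀, Module.finrank K ℓ.direction = 1 := fun ℓ hℓ => hL ℓ (hL₀ hℓ)
  -- lines assigned to `g` lie on `{g = 0}`
  have hLg_on : ∀ n ∈ Lg, ∀ z ∈ n, eval z g = 0 := by
    intro n hn
    rw [hLg] at hn
    obtain ⟨hn0, hng⟩ := mem_filter.1 hn
    have := hasgF n (hng.symm ▸ hg)
    rw [hng] at this
    exact hptw n (mem_union_left _ hn0) g this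
  have hMg_on : ∀ n ∈ Mg, ∀ z ∈ n, eval z g = 0 := by
    intro n hn
    rw [hMg] at hn
    obtain ⟨hn0, hng⟩ := mem_filter.1 hn
    have := hasgF n (hng.symm ▸ hg)
    rw [hng] at this
    exact hptw n (mem_union_right _ hn0) g this
  -- `|J| ≤ |Lg| |Mg|`: a point is determined by its two (distinct) lines
  have hprod : J.card ≤ Lg.card * Mg.card := by
    rw [← card_product]
    refine card_le_card_of_injOn (fun z => (ℓ z, m z)) (fun z hz => ?_) ?_
    · obtain ⟨⟨h1, -, h2⟩, h3, -, h4⟩ := hJ z hz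
      rw [hLg, hMg]
      exact mem_product.2 ⟨mem_filter.2 ⟨h1, h2⟩, mem_filter.2 ⟨h3, h4⟩⟩
    · intro z hz z' hz' h
      simp only [Prod.mk.injEq] at h
      obtain ⟨⟨h1, h2, -⟩, h3, h4, -⟩ := hJ z hz
      obtain ⟨⟨-, h2', -⟩, -, h4', -⟩ := hJ z' hz'
      have hne : ℓ z ≠ m z := fun e => disjoint_left.1 hLM (hL₀ h1) (e ▸ h3)
      exact eq_of_mem_of_mem (hL₀1 _ h1) (hM _ h3) hne h2 h4 (h.1 ▸ h2') (h.2 ▸ h4')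
  have hs0 : (0 : ℝ) ≤ s := Nat.cast_nonneg _
  have ht0 : (0 : ℝ) ≤ t := Nat.cast_nonneg _
  have hLg0 : (0 : ℝ) ≤ Lg.card := Nat.cast_nonneg _
  have hMg0 : (0 : ℝ) ≤ Mg.card := Nat.cast_nonneg _
  have hdg0 : (0 : ℝ) ≤ g.totalDegree := Nat.cast_nonneg _
  have hK0 : 0 ≤ CK * ((g.totalDegree : ℝ) ^ 3 + g.totalDegree * Lg.card + Mg.card) :=
    mul_nonneg hCK (add_nonneg (add_nonneg (pow_nonneg hdg0 3) (mul_nonneg hdg0 hLg0)) hMg0)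
  by_cases hdeg : g.totalDegree ≤ 2
  · -- a plane or a quadric: the hypothesis
    have hq := hquad g (irreducible_of_mem_facs hg).ne_zero hdeg
    have hLg_le : Lg.card ≤ (L.filter fun ℓ => ∀ z ∈ ℓ, eval z g = 0).card :=
      card_le_card fun n hn => mem_filter.2 ⟨hL₀ (by rw [hLg] at hn; exact (mem_filter.1 hn).1),
        hLg_on n hn⟩
    have hMg_le : Mg.card ≤ (M.filter fun m => ∀ z ∈ m, eval z g = 0).card :=
      card_le_card fun n hn => mem_filter.2 ⟨(by rw [hMg] at hn; exact (mem_filter.1 hn).1),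
        hMg_on n hn⟩
    have hcase : Lg.card * Mg.card ≤ s * Mg.card + t * Lg.card := by
      rcases hq with h | h
      · exact (Nat.mul_le_mul_right _ (hLg_le.trans h.le)).trans (Nat.le_add_right _ _)
      · calc Lg.card * Mg.card ≤ Lg.card * t := Nat.mul_le_mul_left _ (hMg_le.trans h.le)
          _ = t * Lg.card := mul_comm _ _
          _ ≤ s * Mg.card + t * Lg.card := Nat.le_add_left _ _
    have h1 : (J.card : ℝ) ≤ s * Mg.card + t * Lg.card := by
      exact_mod_cast hprod.trans hcase
    linarith
  · -- a component of degree `≥ 3`: the component bound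
    push Not at hdeg
    have hcharg : ringChar K = 0 ∨ g.totalDegree < ringChar K :=
      hchar.imp id fun h => lt_of_le_of_lt (hdegD g hg) h
    have hLgL : Lg ⊆ L := fun n hn => hL₀ (by rw [hLg] at hn; exact (mem_filter.1 hn).1)
    have hMgM : Mg ⊆ M := fun n hn => by rw [hMg] at hn; exact (mem_filter.1 hn).1
    have hGg := hGKK g (irreducible_of_mem_facs hg) hdeg hcharg Lg Mg
      (fun n hn => hL n (hLgL hn)) (fun n hn => hM n (hMgM hn))
      (hLM.mono hLgL hMgM) hLg_on hMg_on J
      (fun z hz => by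
        obtain ⟨⟨h1, h2, h5⟩, h3, h4, h6⟩ := hJ z hz
        refine ⟨⟨ℓ z, ?_, h2⟩, ⟨m z, ?_, h4⟩⟩
        · rw [hLg]; exact mem_filter.2 ⟨h1, h5⟩
        · rw [hMg]; exact mem_filter.2 ⟨h3, h6⟩)
    have h2 : (0 : ℝ) ≤ s * Mg.card + t * Lg.card := by positivity
    linarith

open scoped Classical in
/-- **de Zeeuw's proof of Lemma 3.1** for a sub-family `L₀ ⊆ L` small enough that the
interpolating surface has degree `D = ⌊√(6|L₀|)⌋ < p` (no condition in characteristic `0`),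
from the component bound `hGKK` for the field `K` (constant `C_K ≥ 0`): every finite set `I` of
points each lying on a line of `L₀` and a line of `M` has
`|I| ≤ D|M| + D|L₀| + s|M| + t|L₀| + C_K (D³ + D|L₀| + |M|)`.
The five terms are, in the order of the printed proof: intersections of a line of `M` with
components not containing it (Bézout on the line), the same for lines of `L₀`, plane/quadric
components (the hypothesis `hquad`), and components of degree `≥ 3` (`hGKK`); lines are
assigned to the component of least index containing them ("if a line is contained in more
than one component `Sᵢ`, we assign it to the component with smallest index `i`").
[cite: deZeeuw2016, Lemma 3.1 (proof, §3)] -/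
theorem card_le_of_componentBound {CK : ℝ} (hCK : 0 ≤ CK)
    (hGKK : ∀ f : MvPolynomial (Fin 3) K, Irreducible f → 3 ≤ f.totalDegree →
      (ringChar K = 0 ∨ f.totalDegree < ringChar K) →
      ∀ (L M : Finset (AffineSubspace K (Fin 3 → K))),
        (∀ ℓ ∈ L, Module.finrank K ℓ.direction = 1) →
        (∀ m ∈ M, Module.finrank K m.direction = 1) → Disjoint L M →
        (∀ ℓ ∈ L, ∀ z ∈ ℓ, eval z f = 0) → (∀ m ∈ M, ∀ z ∈ m, eval z f = 0) →
        ∀ I : Finset (Fin 3 → K), (∀ z ∈ I, (∃ ℓ ∈ L, z ∈ ℓ) ∧ (∃ m ∈ M, z ∈ m)) →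
          (I.card : ℝ) ≤ CK * ((f.totalDegree : ℝ) ^ 3 + f.totalDegree * L.card + M.card))
    (L M : Finset (AffineSubspace K (Fin 3 → K))) (s t : ℕ)
    (hL : ∀ ℓ ∈ L, Module.finrank K ℓ.direction = 1)
    (hM : ∀ m ∈ M, Module.finrank K m.direction = 1) (hLM : Disjoint L M)
    (hquad : ∀ G : MvPolynomial (Fin 3) K, G ≠ 0 → G.totalDegree ≤ 2 →
      (L.filter fun ℓ => ∀ z ∈ ℓ, eval z G = 0).card < s ∨
      (M.filter fun m => ∀ z ∈ m, eval z G = 0).card < t)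
    (L₀ : Finset (AffineSubspace K (Fin 3 → K))) (hL₀ : L₀ ⊆ L)
    (hchar : ringChar K = 0 ∨ Nat.sqrt (6 * L₀.card) < ringChar K)
    (I : Finset (Fin 3 → K)) (hI : ∀ z ∈ I, (∃ ℓ ∈ L₀, z ∈ ℓ) ∧ (∃ m ∈ M, z ∈ m)) :
    (I.card : ℝ) ≤ pieceBound CK L₀.card M.card s t := by
  unfold pieceBound
  obtain ⟨D, hD⟩ : ∃ D, D = Nat.sqrt (6 * L₀.card) := ⟨_, rfl⟩
  rw [← hD] at hchar ⊢
  have hL₀1 : ∀ ℓ ∈ L₀, Module.finrank K ℓ.direction = 1 := fun ℓ hℓ => hL ℓ (hL₀ hℓ)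
  -- parametrizations of all lines of `L₀ ∪ M`
  have hpar : ∀ n ∈ L₀ ∪ M, ∃ uv : (Fin 3 → K) × (Fin 3 → K), uv.2 ≠ 0 ∧
      ∀ z, z ∈ n ↔ ∃ t : K, z = uv.1 + t • uv.2 := by
    intro n hn
    rcases mem_union.1 hn with h | h
    · exact exists_param n (hL₀1 n h)
    · exact exists_param n (hM n h)
  choose! uv huv0 huv using hpar
  have hptw : ∀ n ∈ L₀ ∪ M, ∀ g : MvPolynomial (Fin 3) K, lineRes (uv n).1 (uv n).2 g = 0 →
      ∀ z ∈ n, eval z g = 0 := by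
    intro n hn g hg z hz
    obtain ⟨t, rfl⟩ := (huv n hn z).1 hz
    exact eval_of_lineRes_eq_zero hg t
  -- interpolation through `L₀`
  obtain ⟨f, hf0, hfdeg, hfvan⟩ :=
    Literature.Combinatorics.Extremal.exists_surface_through_lines (L₀.image uv)
  have hfD : f.totalDegree ≤ D :=
    hfdeg.trans (hD ▸ Nat.sqrt_le_sqrt (Nat.mul_le_mul_left 6 card_image_le))
  have hfL : ∀ ℓ ∈ L₀, lineRes (uv ℓ).1 (uv ℓ).2 f = 0 := fun ℓ hℓ =>
    hfvan _ (mem_image_of_mem _ hℓ)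
  have hsumdeg : ∑ g ∈ facs f, g.totalDegree ≤ D := (sum_totalDegree_facs_le hf0).trans hfD
  have hdegD : ∀ g ∈ facs f, g.totalDegree ≤ D := fun g hg =>
    (totalDegree_le_of_mem_facs hf0 hg).trans hfD
  -- assignment of a line to the factor of least rank vanishing formally on it
  have hasg : ∀ n : AffineSubspace K (Fin 3 → K), ∃ g : MvPolynomial (Fin 3) K,
      (((facs f).filter fun g => lineRes (uv n).1 (uv n).2 g = 0).Nonempty →
        (g ∈ (facs f).filter fun g => lineRes (uv n).1 (uv n).2 g = 0) ∧
        ∀ g' ∈ (facs f).filter fun g => lineRes (uv n).1 (uv n).2 g = 0, rk f g ≤ rk f g') ∧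
      (¬ ((facs f).filter fun g => lineRes (uv n).1 (uv n).2 g = 0).Nonempty → g = 0) := by
    intro n
    by_cases h : ((facs f).filter fun g => lineRes (uv n).1 (uv n).2 g = 0).Nonempty
    · obtain ⟨g, hg, hmin⟩ := exists_min_image _ (rk f) h
      exact ⟨g, fun _ => ⟨hg, hmin⟩, fun h' => absurd h h'⟩
    · exact ⟨0, fun h' => absurd h' h, fun _ => rfl⟩
  choose asg hasg1 hasg2 using hasg
  have hasgF : ∀ n, asg n ∈ facs f → lineRes (uv n).1 (uv n).2 (asg n) = 0 ∧
      ∀ g' ∈ facs f, lineRes (uv n).1 (uv n).2 g' = 0 → rk f (asg n) ≤ rk f g' := by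
    intro n hn
    have hne : ((facs f).filter fun g => lineRes (uv n).1 (uv n).2 g = 0).Nonempty := by
      by_contra h
      exact zero_notMem_facs f (hasg2 n h ▸ hn)
    obtain ⟨hmem, hmin⟩ := hasg1 n hne
    exact ⟨(mem_filter.1 hmem).2, fun g' hg' hg'0 => hmin g' (mem_filter.2 ⟨hg', hg'0⟩)⟩
  have hasg_of : ∀ n, ∀ g ∈ facs f, lineRes (uv n).1 (uv n).2 g = 0 →
      asg n ∈ facs f ∧ rk f (asg n) ≤ rk f g := by
    intro n g hg hg0
    have hne : ((facs f).filter fun g => lineRes (uv n).1 (uv n).2 g = 0).Nonempty :=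
      ⟨g, mem_filter.2 ⟨hg, hg0⟩⟩
    obtain ⟨hmem, hmin⟩ := hasg1 n hne
    exact ⟨(mem_filter.1 hmem).1, hmin g (mem_filter.2 ⟨hg, hg0⟩)⟩
  have hasgL : ∀ ℓ ∈ L₀, asg ℓ ∈ facs f := by
    intro ℓ hℓ
    obtain ⟨g, hg, hg0⟩ := exists_mem_facs_lineRes_eq_zero hf0 (hfL ℓ hℓ)
    exact (hasg_of ℓ g hg hg0).1
  -- the two lines through each point of `I`
  choose! ℓ hℓ hzℓ using fun z (hz : z ∈ I) => (hI z hz).1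
  choose! m hm hzm using fun z (hz : z ∈ I) => (hI z hz).2
  -- the three kinds of points
  obtain ⟨IA, hIA⟩ : ∃ S, S = I.filter fun z => ∃ g ∈ facs f, eval z g = 0 ∧
    lineRes (uv (m z)).1 (uv (m z)).2 g ≠ 0 := ⟨_, rfl⟩
  obtain ⟨IA', hIA'⟩ : ∃ S, S = I.filter fun z => ∃ g ∈ facs f, eval z g = 0 ∧
    lineRes (uv (ℓ z)).1 (uv (ℓ z)).2 g ≠ 0 := ⟨_, rfl⟩
  obtain ⟨IB, hIB⟩ : ∃ S, S = I.filter fun z => asg (m z) = asg (ℓ z) := ⟨_, rfl⟩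
  have hcover : I ⊆ IA ∪ IA' ∪ IB := by
    intro z hz
    have hg₁ : asg (ℓ z) ∈ facs f := hasgL _ (hℓ z hz)
    have hz1 : eval z (asg (ℓ z)) = 0 :=
      hptw _ (mem_union_left _ (hℓ z hz)) _ (hasgF _ hg₁).1 z (hzℓ z hz)
    by_cases h1 : lineRes (uv (m z)).1 (uv (m z)).2 (asg (ℓ z)) = 0
    · obtain ⟨hg₂, hrk⟩ := hasg_of (m z) _ hg₁ h1
      by_cases h2 : asg (m z) = asg (ℓ z)
      · rw [hIB]
        exact mem_union_right _ (mem_filter.2 ⟨hz, h2⟩)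
      · have hlt : rk f (asg (m z)) < rk f (asg (ℓ z)) :=
          lt_of_le_of_ne hrk fun h => h2 (rk_injOn f hg₂ hg₁ h)
        have hz2 : eval z (asg (m z)) = 0 :=
          hptw _ (mem_union_right _ (hm z hz)) _ (hasgF _ hg₂).1 z (hzm z hz)
        by_cases h3 : lineRes (uv (ℓ z)).1 (uv (ℓ z)).2 (asg (m z)) = 0
        · exact absurd ((hasgF _ hg₁).2 _ hg₂ h3) (not_le.2 hlt)
        · rw [hIA']
          exact mem_union_left _ (mem_union_right _
            (mem_filter.2 ⟨hz, asg (m z), hg₂, hz2, h3⟩))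
    · rw [hIA]
      exact mem_union_left _ (mem_union_left _ (mem_filter.2 ⟨hz, asg (ℓ z), hg₁, hz1, h1⟩))
  -- (A), (A'): Bézout on lines
  have hA : IA.card ≤ M.card * D := by
    rw [hIA]
    exact (card_filter_offComponent_le hf0 M uv (fun n hn => huv n (mem_union_right _ hn)) I m
      (fun z hz => ⟨hm z hz, hzm z hz⟩)).trans (Nat.mul_le_mul_left _ hfD)
  have hA' : IA'.card ≤ L₀.card * D := by
    rw [hIA']
    exact (card_filter_offComponent_le hf0 L₀ uv (fun n hn => huv n (mem_union_left _ hn)) I ℓ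
      (fun z hz => ⟨hℓ z hz, hzℓ z hz⟩)).trans (Nat.mul_le_mul_left _ hfD)
  -- (B): same component, fibrewise over the factors
  have hBfib : IB.card = ∑ g ∈ facs f, (IB.filter fun z => asg (ℓ z) = g).card :=
    card_eq_sum_card_fiberwise fun z hz => hasgL _ (hℓ z (by rw [hIB] at hz; exact (mem_filter.1 hz).1))
  have hBg : ∀ g ∈ facs f, ((IB.filter fun z => asg (ℓ z) = g).card : ℝ) ≤
      s * (M.filter fun n => asg n = g).card + t * (L₀.filter fun n => asg n = g).card +
      CK * ((g.totalDegree : ℝ) ^ 3 + g.totalDegree * (L₀.filter fun n => asg n = g).card +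
        (M.filter fun n => asg n = g).card) := by
    intro g hg
    refine card_sameComponent_le hCK hGKK L M s t hL hM hLM hquad L₀ hL₀ hdegD hchar uv hptw
      asg (fun n hn => (hasgF n hn).1) ℓ m hg _ fun z hz => ?_
    obtain ⟨hz1, hz2⟩ := mem_filter.1 hz
    rw [hIB] at hz1
    obtain ⟨hzI, hz3⟩ := mem_filter.1 hz1
    exact ⟨⟨hℓ z hzI, hzℓ z hzI, hz2⟩, hm z hzI, hzm z hzI, hz3.trans hz2⟩
  have hB : (IB.card : ℝ) ≤ s * M.card + t * L₀.card +
      CK * ((D : ℝ) ^ 3 + D * L₀.card + M.card) := by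
    rw [hBfib]
    push_cast
    refine (sum_le_sum hBg).trans ?_
    have e1 : (∑ g ∈ facs f, ((M.filter fun n => asg n = g).card : ℝ)) ≤ M.card := by
      exact_mod_cast sum_card_filter_eq_le M (facs f) asg
    have e2 : (∑ g ∈ facs f, ((L₀.filter fun n => asg n = g).card : ℝ)) ≤ L₀.card := by
      exact_mod_cast sum_card_filter_eq_le L₀ (facs f) asg
    have e3 : (∑ g ∈ facs f, (g.totalDegree : ℝ) ^ 3) ≤ (D : ℝ) ^ 3 := by
      exact_mod_cast sum_pow_three_le (facs f) (fun g => g.totalDegree) hsumdeg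
    have e4 : (∑ g ∈ facs f, (g.totalDegree : ℝ) * (L₀.filter fun n => asg n = g).card) ≤
        D * L₀.card := by
      calc (∑ g ∈ facs f, (g.totalDegree : ℝ) * (L₀.filter fun n => asg n = g).card)
          ≤ ∑ g ∈ facs f, (D : ℝ) * (L₀.filter fun n => asg n = g).card :=
            sum_le_sum fun g hg => mul_le_mul_of_nonneg_right
              (by exact_mod_cast hdegD g hg) (Nat.cast_nonneg _)
        _ = D * ∑ g ∈ facs f, ((L₀.filter fun n => asg n = g).card : ℝ) := by
            rw [mul_sum]
        _ ≤ D * L₀.card := mul_le_mul_of_nonneg_left e2 (Nat.cast_nonneg _)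
    have hs0 : (0 : ℝ) ≤ s := Nat.cast_nonneg _
    have ht0 : (0 : ℝ) ≤ t := Nat.cast_nonneg _
    have hsum_eq : ∑ g ∈ facs f, ((s : ℝ) * (M.filter fun n => asg n = g).card +
          t * (L₀.filter fun n => asg n = g).card +
          CK * ((g.totalDegree : ℝ) ^ 3 + g.totalDegree * (L₀.filter fun n => asg n = g).card
            + (M.filter fun n => asg n = g).card))
        = s * ∑ g ∈ facs f, ((M.filter fun n => asg n = g).card : ℝ) +
          t * ∑ g ∈ facs f, ((L₀.filter fun n => asg n = g).card : ℝ) +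
          CK * (∑ g ∈ facs f, (g.totalDegree : ℝ) ^ 3 +
            ∑ g ∈ facs f, (g.totalDegree : ℝ) * (L₀.filter fun n => asg n = g).card +
            ∑ g ∈ facs f, ((M.filter fun n => asg n = g).card : ℝ)) := by
      simp only [sum_add_distrib, ← mul_sum]
    rw [hsum_eq]
    exact add_le_add (add_le_add (mul_le_mul_of_nonneg_left e1 hs0)
      (mul_le_mul_of_nonneg_left e2 ht0))
      (mul_le_mul_of_nonneg_left (add_le_add (add_le_add e3 e4) e1) hCK)
  -- conclusion
  have hIcard : I.card ≤ IA.card + IA'.card + IB.card :=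
    (card_le_card hcover).trans ((card_union_le _ _).trans
      (Nat.add_le_add_right (card_union_le _ _) _))
  have h1 : (I.card : ℝ) ≤ IA.card + IA'.card + IB.card := by exact_mod_cast hIcard
  have h2 : (IA.card : ℝ) ≤ M.card * D := by exact_mod_cast hA
  have h3 : (IA'.card : ℝ) ≤ L₀.card * D := by exact_mod_cast hA'
  push_cast
  linarith

end Small

/-! ### From pieces to the whole: splitting `L` -/

section Pieces

variable {K : Type*} [Field K]

/-- The trivial bound `|I| ≤ |L| |M|`: a point on a line of `L` and a line of `M` (disjoint
families) is determined by the pair of lines. [folklore] -/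
theorem card_le_card_mul_card (L M : Finset (AffineSubspace K (Fin 3 → K)))
    (hL : ∀ ℓ ∈ L, Module.finrank K ℓ.direction = 1)
    (hM : ∀ m ∈ M, Module.finrank K m.direction = 1) (hLM : Disjoint L M)
    (I : Finset (Fin 3 → K)) (hI : ∀ z ∈ I, (∃ ℓ ∈ L, z ∈ ℓ) ∧ (∃ m ∈ M, z ∈ m)) :
    I.card ≤ L.card * M.card := by
  classical
  choose! ℓ hℓ hzℓ using fun z (hz : z ∈ I) => (hI z hz).1
  choose! m hm hzm using fun z (hz : z ∈ I) => (hI z hz).2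
  rw [← card_product]
  refine card_le_card_of_injOn (fun z => (ℓ z, m z))
    (fun z hz => mem_product.2 ⟨hℓ z hz, hm z hz⟩) fun z hz z' hz' h => ?_
  simp only [Prod.mk.injEq] at h
  have hne : ℓ z ≠ m z := fun e => disjoint_left.1 hLM (hℓ z hz) (e ▸ hm z hz)
  exact eq_of_mem_of_mem (hL _ (hℓ z hz)) (hM _ (hm z hz)) hne (hzℓ z hz) (hzm z hz)
    (h.1 ▸ hzℓ z' hz') (h.2 ▸ hzm z' hz')

/-- **Splitting `L` into pieces**: if every sub-family of `Λ` with at most `N` lines obeys the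
bound `|I₀| ≤ X` (for all finite point sets `I₀` on its lines and on lines of `M`), then a
sub-family with at most `r N` lines obeys `|I| ≤ r X`. [folklore] -/
theorem card_le_mul_of_pieces (Λ M : Finset (AffineSubspace K (Fin 3 → K))) (N : ℕ) {X : ℝ}
    (hX : 0 ≤ X)
    (hpiece : ∀ L₀ ⊆ Λ, L₀.card ≤ N → ∀ I₀ : Finset (Fin 3 → K),
      (∀ z ∈ I₀, (∃ ℓ ∈ L₀, z ∈ ℓ) ∧ (∃ m ∈ M, z ∈ m)) → (I₀.card : ℝ) ≤ X) :
    ∀ (r : ℕ) (L : Finset (AffineSubspace K (Fin 3 → K))), L ⊆ Λ → L.card ≤ r * N →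
      ∀ I : Finset (Fin 3 → K), (∀ z ∈ I, (∃ ℓ ∈ L, z ∈ ℓ) ∧ (∃ m ∈ M, z ∈ m)) →
        (I.card : ℝ) ≤ r * X := by
  classical
  intro r
  induction r with
  | zero =>
    intro L hLΛ hcard I hI
    rw [zero_mul, Nat.le_zero, card_eq_zero] at hcard
    have : I = ∅ := eq_empty_iff_forall_notMem.2 fun z hz => by
      obtain ⟨⟨ℓ, hℓ, -⟩, -⟩ := hI z hz
      rw [hcard] at hℓ
      exact notMem_empty ℓ hℓ
    rw [this]
    simp
  | succ r ih =>
    intro L hLΛ hcard I hI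
    by_cases hsmall : L.card ≤ N
    · calc (I.card : ℝ) ≤ X := hpiece L hLΛ hsmall I hI
        _ = 1 * X := (one_mul X).symm
        _ ≤ (r + 1 : ℕ) * X := by
            refine mul_le_mul_of_nonneg_right ?_ hX
            exact_mod_cast Nat.le_add_left 1 r
    · push Not at hsmall
      obtain ⟨L₁, hL₁L, hL₁card⟩ := exists_subset_card_eq hsmall.le
      set I₁ := I.filter fun z => ∃ ℓ ∈ L₁, z ∈ ℓ with hI₁
      set I₂ := I.filter fun z => ¬ ∃ ℓ ∈ L₁, z ∈ ℓ with hI₂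
      have hIcard : I.card = I₁.card + I₂.card := by
        rw [hI₁, hI₂]
        exact (card_filter_add_card_filter_not _).symm
      have h1 : (I₁.card : ℝ) ≤ X := hpiece L₁ (hL₁L.trans hLΛ) hL₁card.le I₁ fun z hz => by
        obtain ⟨hzI, hz1⟩ := mem_filter.1 hz
        exact ⟨hz1, (hI z hzI).2⟩
      have h2 : (I₂.card : ℝ) ≤ r * X := by
        refine ih (L \ L₁) (sdiff_subset.trans hLΛ) ?_ I₂ fun z hz => ?_
        · rw [card_sdiff_of_subset hL₁L, hL₁card]
          have := hcard
          rw [Nat.succ_mul] at this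
          omega
        · obtain ⟨hzI, hz2⟩ := mem_filter.1 hz
          obtain ⟨⟨ℓ, hℓ, hzℓ⟩, hm⟩ := hI z hzI
          refine ⟨⟨ℓ, mem_sdiff.2 ⟨hℓ, fun hℓ1 => hz2 ⟨ℓ, hℓ1, hzℓ⟩⟩, hzℓ⟩, hm⟩
      rw [hIcard]
      push_cast
      linarith

/-- The estimate `X ≤ (6 + 31 C_K) |L|^{1/2}|M| + s|M| + t|L|` for `1 ≤ |L| ≤ |M|`
(`⌊√(6|L|)⌋ ≤ 3 |L|^{1/2}`). [folklore] -/
theorem pieceBound_le {CK : ℝ} (hCK : 0 ≤ CK) {l m : ℕ} (s t : ℕ) (hl : 1 ≤ l) (hlm : l ≤ m)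
    {u : ℝ} (hu0 : 0 ≤ u) (hu2 : u ^ 2 = l) :
    pieceBound CK l m s t ≤ (6 + 31 * CK) * (u * m) + s * m + t * l := by
  unfold pieceBound
  have hl' : (1 : ℝ) ≤ l := by exact_mod_cast hl
  have hlm' : (l : ℝ) ≤ m := by exact_mod_cast hlm
  have hm0 : (0 : ℝ) ≤ m := Nat.cast_nonneg _
  have hu1 : 1 ≤ u := by nlinarith
  have hD0 : (0 : ℝ) ≤ Nat.sqrt (6 * l) := Nat.cast_nonneg _
  have hD3 : (Nat.sqrt (6 * l) : ℝ) ≤ 3 * u := by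
    have h1 : ((Nat.sqrt (6 * l) : ℕ) : ℝ) ^ 2 ≤ 6 * l := by exact_mod_cast Nat.sqrt_le' (6 * l)
    nlinarith
  have e1 : (Nat.sqrt (6 * l) : ℝ) * m ≤ 3 * (u * m) := by nlinarith
  have e2 : (Nat.sqrt (6 * l) : ℝ) * l ≤ 3 * (u * m) := by nlinarith
  have e3 : (Nat.sqrt (6 * l) : ℝ) ^ 3 ≤ 27 * (u * m) := by
    have h3 : (Nat.sqrt (6 * l) : ℝ) ^ 3 ≤ (3 * u) ^ 3 := by gcongr
    have h27 : (3 * u) ^ 3 = 27 * (u * u ^ 2) := by ring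
    rw [h27, hu2] at h3
    nlinarith
  have e4 : (m : ℝ) ≤ u * m := by nlinarith
  have e5 : CK * ((Nat.sqrt (6 * l) : ℝ) ^ 3 + Nat.sqrt (6 * l) * l + m) ≤
      CK * (27 * (u * m) + 3 * (u * m) + u * m) :=
    mul_le_mul_of_nonneg_left (add_le_add (add_le_add e3 e2) e4) hCK
  push_cast
  linarith

/-- Arithmetic of the piece size `N = (p² - 1)/6` for `p ≥ 3`. [folklore] -/
theorem pieces_arith {p : ℕ} (hp : 3 ≤ p) :
    1 ≤ (p ^ 2 - 1) / 6 ∧ 6 * ((p ^ 2 - 1) / 6) < p ^ 2 ∧ p ^ 2 ≤ 18 * ((p ^ 2 - 1) / 6) := by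
  have h9 : 9 ≤ p ^ 2 := by nlinarith
  refine ⟨by omega, by omega, ?_⟩
  have := Nat.div_add_mod (p ^ 2 - 1) 6
  have := Nat.mod_lt (p ^ 2 - 1) (by norm_num : 0 < 6)
  omega

/-- The final bookkeeping of constants. [folklore] -/
theorem endgame {c₀ CK u l m s t B r X : ℝ} (hc₀ : 0 ≤ c₀) (hCK : 0 ≤ CK) (hu : 0 ≤ u)
    (hl : 0 ≤ l) (hm : 0 ≤ m) (hs : 0 ≤ s) (ht : 0 ≤ t) (hB : B ≤ r * X) (hX0 : 0 ≤ X)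
    (hX : X ≤ (6 + 31 * CK) * (u * m) + s * m + t * l) (hr : r ≤ 18 * c₀ + 1) :
    B ≤ ((18 * c₀ + 2) * (7 + 31 * CK) + 2 * (c₀ + 1)) * (u * m + t * l + s * m) := by
  have hY0 : 0 ≤ u * m + t * l + s * m := by positivity
  have hY : (6 + 31 * CK) * (u * m) + s * m + t * l ≤ (7 + 31 * CK) * (u * m + t * l + s * m) := by
    nlinarith [mul_nonneg hu hm, mul_nonneg ht hl, mul_nonneg hs hm,
      mul_nonneg hCK (mul_nonneg ht hl), mul_nonneg hCK (mul_nonneg hs hm)]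
  calc B ≤ r * X := hB
    _ ≤ (18 * c₀ + 1) * ((7 + 31 * CK) * (u * m + t * l + s * m)) :=
        mul_le_mul hr (hX.trans hY) hX0 (by positivity)
    _ ≤ ((18 * c₀ + 2) * (7 + 31 * CK) + 2 * (c₀ + 1)) * (u * m + t * l + s * m) := by
        nlinarith [mul_nonneg (by positivity : (0 : ℝ) ≤ 7 + 31 * CK) hY0,
          mul_nonneg (by positivity : (0 : ℝ) ≤ 2 * (c₀ + 1)) hY0]

/-- The final bookkeeping of constants for `p = 2`. [folklore] -/
theorem endgame_two {c₀ CK u l m s t B : ℝ} (hc₀ : 0 ≤ c₀) (hCK : 0 ≤ CK) (hu : 0 ≤ u)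
    (hl : 0 ≤ l) (hm : 0 ≤ m) (hs : 0 ≤ s) (ht : 0 ≤ t) (hB : B ≤ l * m) (hu2 : u ^ 2 = l)
    (hl4 : l ≤ 4 * c₀) :
    B ≤ ((18 * c₀ + 2) * (7 + 31 * CK) + 2 * (c₀ + 1)) * (u * m + t * l + s * m) := by
  have h2 : l ≤ 2 * (c₀ + 1) * u := by nlinarith [sq_nonneg (u - 2)]
  have hY0 : 0 ≤ u * m + t * l + s * m := by positivity
  calc B ≤ l * m := hB
    _ ≤ 2 * (c₀ + 1) * u * m := mul_le_mul_of_nonneg_right h2 hm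
    _ = 2 * (c₀ + 1) * (u * m) := by ring
    _ ≤ 2 * (c₀ + 1) * (u * m + t * l + s * m) := by
        refine mul_le_mul_of_nonneg_left ?_ (by positivity)
        nlinarith [mul_nonneg ht hl, mul_nonneg hs hm]
    _ ≤ ((18 * c₀ + 2) * (7 + 31 * CK) + 2 * (c₀ + 1)) * (u * m + t * l + s * m) := by
        nlinarith [mul_nonneg (by positivity : (0 : ℝ) ≤ (18 * c₀ + 2) * (7 + 31 * CK)) hY0]

end Pieces

end DeZeeuw

/-! ### Lemma 3.1 from the component bound -/

open DeZeeuw in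
open scoped Classical in
/-- **de Zeeuw 2016, Lemma 3.1 over one field, from the single-component bound over that
field**, with the explicit constant `C = (18 c₀ + 2)(7 + 31 C_K) + 2 (c₀ + 1)`: the common proof
behind `lineIntersection_of_componentBound` and `lineIntersection_of_componentBound_closed`
(see the former for the mathematics). [cite: deZeeuw2016, Lemma 3.1 (and its proof, §3)] -/
theorem lineIntersection_of_componentBound_at (K : Type) [Field K] {CK c₀ : ℝ} (hCK : 0 < CK)
    (hc₀ : 0 < c₀)
    (hG : ∀ f : MvPolynomial (Fin 3) K,
      Irreducible f → 3 ≤ f.totalDegree → (ringChar K = 0 ∨ f.totalDegree < ringChar K) →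
      ∀ (L M : Finset (AffineSubspace K (Fin 3 → K))),
        (∀ ℓ ∈ L, Module.finrank K ℓ.direction = 1) →
        (∀ m ∈ M, Module.finrank K m.direction = 1) → Disjoint L M →
        (∀ ℓ ∈ L, ∀ z ∈ ℓ, MvPolynomial.eval z f = 0) →
        (∀ m ∈ M, ∀ z ∈ m, MvPolynomial.eval z f = 0) →
        ∀ I : Finset (Fin 3 → K), (∀ z ∈ I, (∃ ℓ ∈ L, z ∈ ℓ) ∧ (∃ m ∈ M, z ∈ m)) →
          (I.card : ℝ) ≤ CK * ((f.totalDegree : ℝ) ^ 3 + f.totalDegree * L.card + M.card))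
    (L M : Finset (AffineSubspace K (Fin 3 → K))) (s t : ℕ)
    (hL : ∀ ℓ ∈ L, Module.finrank K ℓ.direction = 1)
    (hM : ∀ m ∈ M, Module.finrank K m.direction = 1) (hLM : Disjoint L M)
    (hLMcard : L.card ≤ M.card)
    (hchar : ringChar K = 0 ∨ (L.card : ℝ) ≤ c₀ * (ringChar K : ℝ) ^ 2)
    (hquad : ∀ G : MvPolynomial (Fin 3) K, G ≠ 0 → G.totalDegree ≤ 2 →
      (L.filter fun ℓ => ∀ z ∈ ℓ, MvPolynomial.eval z G = 0).card < s ∨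
      (M.filter fun m => ∀ z ∈ m, MvPolynomial.eval z G = 0).card < t)
    (I : Finset (Fin 3 → K)) (hI : ∀ z ∈ I, (∃ ℓ ∈ L, z ∈ ℓ) ∧ (∃ m ∈ M, z ∈ m)) :
    (I.card : ℝ) ≤ ((18 * c₀ + 2) * (7 + 31 * CK) + 2 * (c₀ + 1)) *
      ((L.card : ℝ) ^ (1 / 2 : ℝ) * (M.card : ℝ) + (t : ℝ) * (L.card : ℝ) + (s : ℝ) * (M.card : ℝ)) := by
  have hL0 : (0 : ℝ) ≤ L.card := Nat.cast_nonneg _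
  have hM0 : (0 : ℝ) ≤ M.card := Nat.cast_nonneg _
  have hs0 : (0 : ℝ) ≤ s := Nat.cast_nonneg _
  have ht0 : (0 : ℝ) ≤ t := Nat.cast_nonneg _
  set u : ℝ := (L.card : ℝ) ^ (1 / 2 : ℝ) with hu
  have hu0 : 0 ≤ u := by positivity
  have hu2 : u ^ 2 = L.card := by
    rw [hu, ← Real.rpow_natCast, ← Real.rpow_mul hL0]; norm_num
  -- `L = ∅`
  rcases L.eq_empty_or_nonempty with hLe | hLne
  · have : I = ∅ := eq_empty_iff_forall_notMem.2 fun z hz => by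
      obtain ⟨⟨ℓ, hℓ, -⟩, -⟩ := hI z hz
      rw [hLe] at hℓ
      exact notMem_empty ℓ hℓ
    rw [this, card_empty, Nat.cast_zero]
    positivity
  have hL1 : 1 ≤ L.card := card_pos.2 hLne
  -- the uniform per-piece bound
  have hX0 : 0 ≤ pieceBound CK L.card M.card s t := pieceBound_nonneg hCK.le _ _ _ _
  have hXle := pieceBound_le hCK.le s t hL1 hLMcard hu0 hu2
  have hpiece : ∀ L₀ ⊆ L, (ringChar K = 0 ∨ Nat.sqrt (6 * L₀.card) < ringChar K) →
      ∀ I₀ : Finset (Fin 3 → K), (∀ z ∈ I₀, (∃ ℓ ∈ L₀, z ∈ ℓ) ∧ (∃ m ∈ M, z ∈ m)) →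
        (I₀.card : ℝ) ≤ pieceBound CK L.card M.card s t := by
    intro L₀ hL₀ hch I₀ hI₀
    exact (card_le_of_componentBound hCK.le hG L M s t hL hM hLM hquad L₀ hL₀ hch I₀
      hI₀).trans (pieceBound_mono hCK.le (card_le_card hL₀) _ _ _)
  -- the characteristic
  rcases CharP.char_is_prime_or_zero K (ringChar K) with hp | hp
  · have hLc : (L.card : ℝ) ≤ c₀ * (ringChar K : ℝ) ^ 2 := hchar.resolve_left hp.ne_zero
    by_cases hp2 : ringChar K = 2
    · -- `p = 2`: the trivial bound
      rw [hp2] at hLc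
      norm_num at hLc
      have h1 : (I.card : ℝ) ≤ L.card * M.card := by
        exact_mod_cast card_le_card_mul_card L M hL hM hLM I hI
      exact endgame_two hc₀.le hCK.le hu0 hL0 hM0 hs0 ht0 h1 hu2 (by linarith)
    · -- `p ≥ 3`: pieces of size `N = (p² - 1)/6`
      have hp3 : 3 ≤ ringChar K := by
        have := hp.two_le
        omega
      obtain ⟨hN1, hNp, hN18⟩ := pieces_arith hp3
      set p := ringChar K with hpdef
      set N := (p ^ 2 - 1) / 6 with hN
      have hsmall : ∀ L₀ ⊆ L, L₀.card ≤ N →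
          ringChar K = 0 ∨ Nat.sqrt (6 * L₀.card) < ringChar K := by
        intro L₀ _ hc
        right
        rw [← hpdef, Nat.sqrt_lt']
        exact lt_of_le_of_lt (Nat.mul_le_mul_left 6 hc) hNp
      set r := L.card / N + 1 with hr
      have hrL : L.card ≤ r * N := by
        rw [hr, Nat.add_mul, one_mul]
        have h1 := Nat.div_add_mod (L.card) N
        have h2 := Nat.mod_lt (L.card) hN1
        rw [mul_comm] at h1
        omega
      have hmain := card_le_mul_of_pieces L M N hX0
        (fun L₀ hL₀ hc I₀ hI₀ => hpiece L₀ hL₀ (hsmall L₀ hL₀ hc) I₀ hI₀) r L Subset.rfl hrL I hI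
      -- `r ≤ 18 c₀ + 1`
      have hrle : (r : ℝ) ≤ 18 * c₀ + 1 := by
        rw [hr]
        push_cast
        have hdiv : ((L.card / N : ℕ) : ℝ) ≤ (L.card : ℝ) / N := Nat.cast_div_le
        have hNpos : (0 : ℝ) < N := by exact_mod_cast hN1
        have hN18' : ((p : ℕ) : ℝ) ^ 2 ≤ 18 * N := by exact_mod_cast hN18
        have h2 : (L.card : ℝ) / N ≤ 18 * c₀ := by
          rw [div_le_iff₀ hNpos]
          nlinarith [hLc, hN18', hc₀.le]
        linarith
      exact endgame hc₀.le hCK.le hu0 hL0 hM0 hs0 ht0 hmain hX0 hXle hrle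
  · -- characteristic `0`: one piece
    have h := hpiece L Subset.rfl (Or.inl hp) I hI
    exact endgame hc₀.le hCK.le hu0 hL0 hM0 hs0 ht0 (r := 1) (by linarith) hX0 hXle
      (by linarith)

open DeZeeuw in
open scoped Classical in
/-- **de Zeeuw 2016, Lemma 3.1, from the single-component bound.** The hypothesis `GKK` is the
merge of [Kollar2015, Prop. 55 (4), (5); §7 (54); Cor. 21; Cor. 40] used in the printed proof
(see the module docstring): an absolute constant `C_K` such that on an irreducible surface
`{f = 0} ⊆ K³` of degree `d ≥ 3` (`char K = 0` or `d < char K`), finite disjoint families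
`L', M'` of lines produce at most `C_K (d³ + d|L'| + |M'|)` points lying on a line of each.
The conclusion is Lemma 3.1 exactly as rendered in the hypothesis `H` of
`rudnev_pointPlaneIncidence_of_lineIntersection`: it is obtained from
`DeZeeuw.card_le_of_componentBound` (the printed proof, which needs the interpolating degree
`⌊√(6|L|)⌋ < p`) by splitting `L` into at most `18 c₀ + 1` pieces of size `≤ (p² - 1)/6` when
`p ≥ 3`, and by the trivial bound `|I| ≤ |L||M| ≤ 2(c₀ + 1) |L|^{1/2}|M|` when `p = 2`; the
constant is `C = (18 c₀ + 2)(7 + 31 C_K) + 2 (c₀ + 1)`.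
[cite: deZeeuw2016, Lemma 3.1 (and its proof, §3)] -/
theorem lineIntersection_of_componentBound
    (GKK : ∃ CK : ℝ, 0 < CK ∧ ∀ (K : Type) [Field K] (f : MvPolynomial (Fin 3) K),
      Irreducible f → 3 ≤ f.totalDegree → (ringChar K = 0 ∨ f.totalDegree < ringChar K) →
      ∀ (L M : Finset (AffineSubspace K (Fin 3 → K))),
        (∀ ℓ ∈ L, Module.finrank K ℓ.direction = 1) →
        (∀ m ∈ M, Module.finrank K m.direction = 1) → Disjoint L M →
        (∀ ℓ ∈ L, ∀ z ∈ ℓ, MvPolynomial.eval z f = 0) →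
        (∀ m ∈ M, ∀ z ∈ m, MvPolynomial.eval z f = 0) →
        ∀ I : Finset (Fin 3 → K), (∀ z ∈ I, (∃ ℓ ∈ L, z ∈ ℓ) ∧ (∃ m ∈ M, z ∈ m)) →
          (I.card : ℝ) ≤ CK * ((f.totalDegree : ℝ) ^ 3 + f.totalDegree * L.card + M.card)) :
    ∀ c₀ : ℝ, 0 < c₀ → ∃ C : ℝ, 0 < C ∧
      ∀ (K : Type) [Field K] (L M : Finset (AffineSubspace K (Fin 3 → K))) (s t : ℕ),
        (∀ ℓ ∈ L, Module.finrank K ℓ.direction = 1) →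
        (∀ m ∈ M, Module.finrank K m.direction = 1) →
        Disjoint L M →
        L.card ≤ M.card →
        (ringChar K = 0 ∨ (L.card : ℝ) ≤ c₀ * (ringChar K : ℝ) ^ 2) →
        (∀ G : MvPolynomial (Fin 3) K, G ≠ 0 → G.totalDegree ≤ 2 →
          (L.filter fun ℓ => ∀ z ∈ ℓ, MvPolynomial.eval z G = 0).card < s ∨
          (M.filter fun m => ∀ z ∈ m, MvPolynomial.eval z G = 0).card < t) →
        ∀ I : Finset (Fin 3 → K),
          (∀ z ∈ I, (∃ ℓ ∈ L, z ∈ ℓ) ∧ (∃ m ∈ M, z ∈ m)) →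
          (I.card : ℝ) ≤ C * ((L.card : ℝ) ^ (1 / 2 : ℝ) * (M.card : ℝ)
            + (t : ℝ) * (L.card : ℝ) + (s : ℝ) * (M.card : ℝ)) := by
  obtain ⟨CK, hCK, hG⟩ := GKK
  intro c₀ hc₀
  exact ⟨(18 * c₀ + 2) * (7 + 31 * CK) + 2 * (c₀ + 1), by positivity,
    fun K _ L M s t hL hM hLM hLMcard hchar hquad I hI =>
      lineIntersection_of_componentBound_at K hCK hc₀ (hG K) L M s t hL hM hLM hLMcard hchar
        hquad I hI⟩

open DeZeeuw in
open scoped Classical in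
/-- **de Zeeuw 2016, Lemma 3.1 over algebraically closed fields, from the single-component
bound over algebraically closed fields** — the setting of Kollár's theory of lines on surfaces
[Kollar2015, §7] and all that `rudnev_pointPlaneIncidence_of_lineIntersection_closed` needs.
As in `lineIntersection_of_componentBound`: the hypothesis `GKK` is the
merge of [Kollar2015, Prop. 55 (4), (5); §7 (54); Cor. 21; Cor. 40] used in the printed proof
(see the module docstring): an absolute constant `C_K` such that on an irreducible surface
`{f = 0} ⊆ K³` of degree `d ≥ 3` (`char K = 0` or `d < char K`), finite disjoint families
`L', M'` of lines produce at most `C_K (d³ + d|L'| + |M'|)` points lying on a line of each.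
The conclusion is Lemma 3.1 exactly as rendered in the hypothesis `H` of
`rudnev_pointPlaneIncidence_of_lineIntersection`: it is obtained from
`DeZeeuw.card_le_of_componentBound` (the printed proof, which needs the interpolating degree
`⌊√(6|L|)⌋ < p`) by splitting `L` into at most `18 c₀ + 1` pieces of size `≤ (p² - 1)/6` when
`p ≥ 3`, and by the trivial bound `|I| ≤ |L||M| ≤ 2(c₀ + 1) |L|^{1/2}|M|` when `p = 2`; the
constant is `C = (18 c₀ + 2)(7 + 31 C_K) + 2 (c₀ + 1)`.
[cite: deZeeuw2016, Lemma 3.1 (and its proof, §3)] -/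
theorem lineIntersection_of_componentBound_closed
    (GKK : ∃ CK : ℝ, 0 < CK ∧ ∀ (K : Type) [Field K] [IsAlgClosed K] (f : MvPolynomial (Fin 3) K),
      Irreducible f → 3 ≤ f.totalDegree → (ringChar K = 0 ∨ f.totalDegree < ringChar K) →
      ∀ (L M : Finset (AffineSubspace K (Fin 3 → K))),
        (∀ ℓ ∈ L, Module.finrank K ℓ.direction = 1) →
        (∀ m ∈ M, Module.finrank K m.direction = 1) → Disjoint L M →
        (∀ ℓ ∈ L, ∀ z ∈ ℓ, MvPolynomial.eval z f = 0) →
        (∀ m ∈ M, ∀ z ∈ m, MvPolynomial.eval z f = 0) →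
        ∀ I : Finset (Fin 3 → K), (∀ z ∈ I, (∃ ℓ ∈ L, z ∈ ℓ) ∧ (∃ m ∈ M, z ∈ m)) →
          (I.card : ℝ) ≤ CK * ((f.totalDegree : ℝ) ^ 3 + f.totalDegree * L.card + M.card)) :
    ∀ c₀ : ℝ, 0 < c₀ → ∃ C : ℝ, 0 < C ∧
      ∀ (K : Type) [Field K] [IsAlgClosed K] (L M : Finset (AffineSubspace K (Fin 3 → K)))
        (s t : ℕ),
        (∀ ℓ ∈ L, Module.finrank K ℓ.direction = 1) →
        (∀ m ∈ M, Module.finrank K m.direction = 1) →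
        Disjoint L M →
        L.card ≤ M.card →
        (ringChar K = 0 ∨ (L.card : ℝ) ≤ c₀ * (ringChar K : ℝ) ^ 2) →
        (∀ G : MvPolynomial (Fin 3) K, G ≠ 0 → G.totalDegree ≤ 2 →
          (L.filter fun ℓ => ∀ z ∈ ℓ, MvPolynomial.eval z G = 0).card < s ∨
          (M.filter fun m => ∀ z ∈ m, MvPolynomial.eval z G = 0).card < t) →
        ∀ I : Finset (Fin 3 → K),
          (∀ z ∈ I, (∃ ℓ ∈ L, z ∈ ℓ) ∧ (∃ m ∈ M, z ∈ m)) →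
          (I.card : ℝ) ≤ C * ((L.card : ℝ) ^ (1 / 2 : ℝ) * (M.card : ℝ)
            + (t : ℝ) * (L.card : ℝ) + (s : ℝ) * (M.card : ℝ)) := by
  obtain ⟨CK, hCK, hG⟩ := GKK
  intro c₀ hc₀
  exact ⟨(18 * c₀ + 2) * (7 + 31 * CK) + 2 * (c₀ + 1), by positivity,
    fun K _ _ L M s t hL hM hLM hLMcard hchar hquad I hI =>
      lineIntersection_of_componentBound_at K hCK hc₀ (hG K) L M s t hL hM hLM hLMcard hchar
        hquad I hI⟩

open DeZeeuw in
open scoped Classical in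
/-- **Rudnev's point–plane theorem from the single-component bound**: the chain
`GKK ⟹ Lemma 3.1 ⟹ Theorem 1.1` (de Zeeuw 2016, §§3, 2, 4).
[cite: deZeeuw2016, Theorem 1.1; Rudnev2017, Theorem 3] -/
theorem rudnev_pointPlaneIncidence_of_componentBound
    (GKK : ∃ CK : ℝ, 0 < CK ∧ ∀ (K : Type) [Field K] (f : MvPolynomial (Fin 3) K),
      Irreducible f → 3 ≤ f.totalDegree → (ringChar K = 0 ∨ f.totalDegree < ringChar K) →
      ∀ (L M : Finset (AffineSubspace K (Fin 3 → K))),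
        (∀ ℓ ∈ L, Module.finrank K ℓ.direction = 1) →
        (∀ m ∈ M, Module.finrank K m.direction = 1) → Disjoint L M →
        (∀ ℓ ∈ L, ∀ z ∈ ℓ, MvPolynomial.eval z f = 0) →
        (∀ m ∈ M, ∀ z ∈ m, MvPolynomial.eval z f = 0) →
        ∀ I : Finset (Fin 3 → K), (∀ z ∈ I, (∃ ℓ ∈ L, z ∈ ℓ) ∧ (∃ m ∈ M, z ∈ m)) →
          (I.card : ℝ) ≤ CK * ((f.totalDegree : ℝ) ^ 3 + f.totalDegree * L.card + M.card)) :
    ∀ c₀ : ℝ, 0 < c₀ → ∃ C : ℝ, 0 < C ∧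
      ∀ (F : Type) [Field F] (P : Finset (Fin 3 → F)) (Q : Finset (AffineSubspace F (Fin 3 → F)))
        (k : ℕ),
        (∀ π ∈ Q, Module.finrank F π.direction = 2) →
        P.card ≤ Q.card →
        (ringChar F = 0 ∨ (P.card : ℝ) ≤ c₀ * (ringChar F : ℝ) ^ 2) →
        (∀ ℓ : AffineSubspace F (Fin 3 → F), Module.finrank F ℓ.direction = 1 →
          (P.filter fun q => q ∈ ℓ).card ≤ k) →
        (((P ×ˢ Q).filter fun i => i.1 ∈ i.2).card : ℝ) ≤
          C * ((P.card : ℝ) ^ (1 / 2 : ℝ) * (Q.card : ℝ) + (k : ℝ) * (Q.card : ℝ)) :=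
  rudnev_pointPlaneIncidence_of_lineIntersection (lineIntersection_of_componentBound GKK)

open DeZeeuw in
open scoped Classical in
/-- **Stevens–de Zeeuw, Theorem 4, from the single-component bound**: the named fact
`stevensDeZeeuw_thm4` follows from `GKK` (Kollár's bounds for lines on one irreducible surface
of degree `≥ 3`) by de Zeeuw's Lemma 3.1 (this file), Theorem 1.1
(`DeZeeuwPointPlaneReduction.lean`) and Stevens–de Zeeuw §2
(`StevensDeZeeuwIncidenceProofs.lean`). [cite: StevensDeZeeuw2017, Theorem 4] -/
theorem stevensDeZeeuw_thm4_of_componentBound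
    (GKK : ∃ CK : ℝ, 0 < CK ∧ ∀ (K : Type) [Field K] (f : MvPolynomial (Fin 3) K),
      Irreducible f → 3 ≤ f.totalDegree → (ringChar K = 0 ∨ f.totalDegree < ringChar K) →
      ∀ (L M : Finset (AffineSubspace K (Fin 3 → K))),
        (∀ ℓ ∈ L, Module.finrank K ℓ.direction = 1) →
        (∀ m ∈ M, Module.finrank K m.direction = 1) → Disjoint L M →
        (∀ ℓ ∈ L, ∀ z ∈ ℓ, MvPolynomial.eval z f = 0) →
        (∀ m ∈ M, ∀ z ∈ m, MvPolynomial.eval z f = 0) →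
        ∀ I : Finset (Fin 3 → K), (∀ z ∈ I, (∃ ℓ ∈ L, z ∈ ℓ) ∧ (∃ m ∈ M, z ∈ m)) →
          (I.card : ℝ) ≤ CK * ((f.totalDegree : ℝ) ^ 3 + f.totalDegree * L.card + M.card)) :
    stevensDeZeeuw_thm4 :=
  stevensDeZeeuw_thm4_of_lineIntersection (lineIntersection_of_componentBound GKK)


open DeZeeuw in
open scoped Classical in
/-- **Rudnev's point–plane theorem from the single-component bound over algebraically closed
fields**: the chain `GKK (K algebraically closed) ⟹ Lemma 3.1 (K algebraically closed) ⟹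
Theorem 1.1` (de Zeeuw 2016, §§3, 2, 4). [cite: deZeeuw2016, Theorem 1.1; Rudnev2017, Theorem 3] -/
theorem rudnev_pointPlaneIncidence_of_componentBound_closed
    (GKK : ∃ CK : ℝ, 0 < CK ∧ ∀ (K : Type) [Field K] [IsAlgClosed K] (f : MvPolynomial (Fin 3) K),
      Irreducible f → 3 ≤ f.totalDegree → (ringChar K = 0 ∨ f.totalDegree < ringChar K) →
      ∀ (L M : Finset (AffineSubspace K (Fin 3 → K))),
        (∀ ℓ ∈ L, Module.finrank K ℓ.direction = 1) →
        (∀ m ∈ M, Module.finrank K m.direction = 1) → Disjoint L M →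
        (∀ ℓ ∈ L, ∀ z ∈ ℓ, MvPolynomial.eval z f = 0) →
        (∀ m ∈ M, ∀ z ∈ m, MvPolynomial.eval z f = 0) →
        ∀ I : Finset (Fin 3 → K), (∀ z ∈ I, (∃ ℓ ∈ L, z ∈ ℓ) ∧ (∃ m ∈ M, z ∈ m)) →
          (I.card : ℝ) ≤ CK * ((f.totalDegree : ℝ) ^ 3 + f.totalDegree * L.card + M.card)) :
    ∀ c₀ : ℝ, 0 < c₀ → ∃ C : ℝ, 0 < C ∧
      ∀ (F : Type) [Field F] (P : Finset (Fin 3 → F)) (Q : Finset (AffineSubspace F (Fin 3 → F)))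
        (k : ℕ),
        (∀ π ∈ Q, Module.finrank F π.direction = 2) →
        P.card ≤ Q.card →
        (ringChar F = 0 ∨ (P.card : ℝ) ≤ c₀ * (ringChar F : ℝ) ^ 2) →
        (∀ ℓ : AffineSubspace F (Fin 3 → F), Module.finrank F ℓ.direction = 1 →
          (P.filter fun q => q ∈ ℓ).card ≤ k) →
        (((P ×ˢ Q).filter fun i => i.1 ∈ i.2).card : ℝ) ≤
          C * ((P.card : ℝ) ^ (1 / 2 : ℝ) * (Q.card : ℝ) + (k : ℝ) * (Q.card : ℝ)) :=
  rudnev_pointPlaneIncidence_of_lineIntersection_closed (lineIntersection_of_componentBound_closed GKK)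

open DeZeeuw in
open scoped Classical in
/-- **Stevens–de Zeeuw, Theorem 4, from the single-component bound over algebraically closed
fields**: the named fact `stevensDeZeeuw_thm4` follows from `GKK` restricted to algebraically
closed fields — Kollár's bounds for lines on one irreducible surface of degree `d ≥ 3` in `K³`,
`K` algebraically closed, `char K = 0` or `d < char K` [Kollar2015, Prop. 55, §7 (54), Cor. 21,
Cor. 40] — by de Zeeuw's Lemma 3.1 (this file), Theorem 1.1 (`DeZeeuwPointPlaneReduction.lean`)
and Stevens–de Zeeuw §2 (`StevensDeZeeuwIncidenceProofs.lean`). This is the sharpest form of the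
reduction: the remaining input concerns a single absolutely irreducible surface.
[cite: StevensDeZeeuw2017, Theorem 4] -/
theorem stevensDeZeeuw_thm4_of_componentBound_closed
    (GKK : ∃ CK : ℝ, 0 < CK ∧ ∀ (K : Type) [Field K] [IsAlgClosed K] (f : MvPolynomial (Fin 3) K),
      Irreducible f → 3 ≤ f.totalDegree → (ringChar K = 0 ∨ f.totalDegree < ringChar K) →
      ∀ (L M : Finset (AffineSubspace K (Fin 3 → K))),
        (∀ ℓ ∈ L, Module.finrank K ℓ.direction = 1) →
        (∀ m ∈ M, Module.finrank K m.direction = 1) → Disjoint L M →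
        (∀ ℓ ∈ L, ∀ z ∈ ℓ, MvPolynomial.eval z f = 0) →
        (∀ m ∈ M, ∀ z ∈ m, MvPolynomial.eval z f = 0) →
        ∀ I : Finset (Fin 3 → K), (∀ z ∈ I, (∃ ℓ ∈ L, z ∈ ℓ) ∧ (∃ m ∈ M, z ∈ m)) →
          (I.card : ℝ) ≤ CK * ((f.totalDegree : ℝ) ^ 3 + f.totalDegree * L.card + M.card)) :
    stevensDeZeeuw_thm4 :=
  stevensDeZeeuw_thm4_of_lineIntersection_closed (lineIntersection_of_componentBound_closed GKK)

end Literature.Combinatorics.Additive
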